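import Summits.CriticalPhenomena.PercolationContinuityZ3.Theorems.PercNearOneGluingNoHeavyPcintBFibBridgeT
import Summits.CriticalPhenomena.PercolationContinuityZ3.Theorems.PercNearOneGluingNoHeavyPcintAdaptiveDominationMarginals
import Summits.CriticalPhenomena.PercolationContinuityZ3.Theorems.PercNearOneGluingNoHeavyPcintProductResampling
import HarnessLib

/-!
# PCINT lane, T-fibre route PHASE 3 (bond), step (5b): marginals of product weights and `P_p` as a sum over coordinates

Cell `prim-pcint`, seat `prim-pcint-1` (gen 13); memo `run/shared/lean/prim/pcint/T-FIBRE-ROUTE.md` (PHASE 3).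
Finite-sum lemmas for the fibre-side bridge of the bond route (`…PcintBFibBridgeF.lean`):

* `AdaptDom.sum_wt_comp_of_injective` — **marginalisation along an injection** `ι : Y ↪ X`:
  `Σ_{x : X → Bool} π_q(x) g(x ∘ ι) = Σ_{a : Y → Bool} π_q(a) g(a)` (the unread coordinates integrate out);
* `AdaptDom.sum_pw_eq_sum_wt_curry` — a block product weight `pw π_q` on `B → (K → Bool)` is the product weight `π_q` on
  `B × K → Bool` (flattening);
* `EdgeExpl.real_eq_sum_wt_of_injective` — for an injective parametrisation `edge : Y → E(G)` of some edges of a graph and an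
  event determined by those edges, `P_p(𝓔) = Σ_{a : Y → Bool} π_p(a) 𝟙[edgeCfg a ∈ 𝓔]` (`real_eq_sum_of_determinedBy` +
  `cylWeight_eq_wt`, reindexed along `Y ≃ image`).
-/

noncomputable section

namespace Summit.CriticalPhenomena.PercolationContinuityZ3.Theorems.Pcint

open Finset

namespace AdaptDom

variable {X Y : Type*} [Fintype X] [DecidableEq X] [Fintype Y] [DecidableEq Y]

omit [DecidableEq Y] in
/-- The fibre of the restriction map `x ↦ x ∘ ι` over `a` has `π_q`-mass `π_q(a)` (for `ι` injective). -/
theorem sum_wt_filter_comp_eq (q : ℝ) {ι : Y → X} (hι : Function.Injective ι) (a : Y → Bool) :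
    ∑ x ∈ univ.filter (fun x : X → Bool => x ∘ ι = a), wt q x = wt q a := by
  classical
  let x₀ : X → Bool := fun c => if h : ∃ y, ι y = c then a (Classical.choose h) else false
  have hx₀ : ∀ y, x₀ (ι y) = a y := by
    intro y
    have h : ∃ y', ι y' = ι y := ⟨y, rfl⟩
    simp only [x₀, dif_pos h]
    exact congrArg a (hι (Classical.choose_spec h))
  have hfilt : univ.filter (fun x : X → Bool => x ∘ ι = a) =
      univ.filter (fun x : X → Bool => ∀ v ∈ univ.image ι, x v = x₀ v) := by
    ext x
    simp only [mem_filter, mem_univ, true_and, mem_image, forall_exists_index]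
    constructor
    · rintro h v y rfl; rw [hx₀ y, ← h]; rfl
    · intro h; funext y; rw [Function.comp_apply, h (ι y) y rfl, hx₀ y]
  rw [hfilt, sum_wt_filter_agree q (univ.image ι) x₀, Finset.prod_image (fun y _ y' _ h => hι h)]
  unfold wt
  exact Finset.prod_congr rfl fun y _ => by rw [hx₀ y]

/-- **Marginalisation along an injection**: the unread coordinates integrate out. -/
theorem sum_wt_comp_of_injective (q : ℝ) {ι : Y → X} (hι : Function.Injective ι) (g : (Y → Bool) → ℝ) :
    ∑ x : X → Bool, wt q x * g (x ∘ ι) = ∑ a : Y → Bool, wt q a * g a := by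
  classical
  rw [← Finset.sum_fiberwise_of_maps_to (s := (univ : Finset (X → Bool))) (t := (univ : Finset (Y → Bool)))
    (g := fun x : X → Bool => x ∘ ι) (fun _ _ => mem_univ _)]
  refine Finset.sum_congr rfl fun a _ => ?_
  rw [← sum_wt_filter_comp_eq q hι a, Finset.sum_mul]
  refine Finset.sum_congr rfl fun x hx => ?_
  rw [(mem_filter.1 hx).2]

variable {B K : Type*} [Fintype B] [DecidableEq B] [Fintype K] [DecidableEq K]

omit [DecidableEq B] [DecidableEq K] in
/-- A block product weight is the product weight of the flattened configuration. -/
theorem pw_eq_wt_uncurry (q : ℝ) (w : B → K → Bool) : pw (fun _ => wt q) w = wt q (Function.uncurry w) := by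
  unfold pw wt
  show ∏ b, ∏ k, bern q (w b k) = ∏ v : B × K, bern q (w v.1 v.2)
  exact (Fintype.prod_prod_type' (fun b k => bern q (w b k))).symm

/-- **Flattening**: a `pw π_q`-integral over block assignments is a `π_q`-integral over `B × K → Bool`. -/
theorem sum_pw_eq_sum_wt_curry (q : ℝ) (G : (B → K → Bool) → ℝ) :
    ∑ w : B → K → Bool, pw (fun _ => wt q) w * G w = ∑ x : B × K → Bool, wt q x * G (Function.curry x) := by
  rw [← (Equiv.curry B K Bool).sum_comp]
  refine Finset.sum_congr rfl fun x _ => ?_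
  rw [pw_eq_wt_uncurry]
  rfl

end AdaptDom

namespace EdgeExpl

open AdaptDom Literature.Probability.Percolation Literature.Probability.LatticeModels

variable {V' : Type*} {Y : Type*} [Fintype Y] [DecidableEq Y]

/-- The configuration with open edges `{edge y : a y}`. -/
def edgeCfg (edge : Y → Sym2 V') (a : Y → Bool) : BondConfig V' := {E | ∃ y, a y = true ∧ E = edge y}

omit [Fintype Y] [DecidableEq Y] in
/-- Membership of a parametrised edge in `edgeCfg` (for `edge` injective). -/
theorem edge_mem_edgeCfg_iff {edge : Y → Sym2 V'} (hinj : Function.Injective edge) {a : Y → Bool} {y : Y} :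
    edge y ∈ edgeCfg edge a ↔ a y = true := by
  constructor
  · rintro ⟨y', hy', h⟩; rw [hinj h]; exact hy'
  · intro h; exact ⟨y, h, rfl⟩

/-- **`P_p` as a sum over an injective edge parametrisation**: for `edge : Y → E(G)` injective and an event determined by
its range, `P_p(𝓔) = Σ_{a : Y → Bool} π_p(a) · 𝟙[edgeCfg edge a ∈ 𝓔]`. -/
theorem real_eq_sum_wt_of_injective (G' : SimpleGraph V') (p : unitInterval) (edge : Y → Sym2 V')
    (hinj : Function.Injective edge) (hedge : ∀ y, edge y ∈ G'.edgeSet) {𝓔 : Set (BondConfig V')}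
    (h𝓔 : DeterminedBy 𝓔 (Set.range edge)) :
    (bondPercolation G' p).real 𝓔 = ∑ a : Y → Bool, wt (p : ℝ) a * 𝓔.indicator 1 (edgeCfg edge a) := by
  classical
  set F : Finset (Sym2 V') := univ.image edge with hF
  have hFr : (↑F : Set (Sym2 V')) = Set.range edge := by rw [hF, coe_image, coe_univ, Set.image_univ]
  have h𝓔' : DeterminedBy 𝓔 (↑F : Set (Sym2 V')) := by rw [hFr]; exact h𝓔
  rw [real_eq_sum_of_determinedBy G' p F h𝓔']
  have hFE : ∀ e ∈ F, e ∈ G'.edgeSet := by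
    intro e he; obtain ⟨y, -, rfl⟩ := mem_image.1 he; exact hedge y
  -- reindex along `Y ≃ ↥F`
  let eqv : Y ≃ ↥F :=
    { toFun := fun y => ⟨edge y, mem_image_of_mem _ (mem_univ y)⟩
      invFun := fun b => Classical.choose (mem_image.1 b.2)
      left_inv := fun y => hinj (Classical.choose_spec (mem_image.1 (mem_image_of_mem edge (mem_univ y)))).2
      right_inv := fun b => Subtype.ext (Classical.choose_spec (mem_image.1 b.2)).2 }
  rw [← (eqv.arrowCongr (Equiv.refl Bool)).symm.sum_comp]
  have key : ∀ b : ↥F → Bool, cylWeight G' p F b * 𝓔.indicator 1 (cfgOf F b) =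
      wt (p : ℝ) ((eqv.arrowCongr (Equiv.refl Bool)).symm b) *
        𝓔.indicator 1 (edgeCfg edge ((eqv.arrowCongr (Equiv.refl Bool)).symm b)) := by
    intro b
    have hb : ∀ y, (eqv.arrowCongr (Equiv.refl Bool)).symm b y = b (eqv y) := fun y => rfl
    have hwt : wt (p : ℝ) ((eqv.arrowCongr (Equiv.refl Bool)).symm b) = wt (p : ℝ) b := by
      unfold wt; simp only [hb]; exact eqv.prod_comp (fun f => bern (p : ℝ) (b f))
    have hcfg : edgeCfg edge ((eqv.arrowCongr (Equiv.refl Bool)).symm b) = cfgOf F b := by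
      ext E
      simp only [cfgOf, edgeCfg, Set.mem_setOf_eq, hb]
      constructor
      · rintro ⟨y, hy, rfl⟩; exact ⟨mem_image_of_mem _ (mem_univ y), hy⟩
      · rintro ⟨hE, hbE⟩
        obtain ⟨y, -, hy⟩ := mem_image.1 hE
        subst hy
        exact ⟨y, hbE, rfl⟩
    rw [cylWeight_eq_wt p F hFE, hwt, hcfg]
  exact (Finset.sum_congr rfl fun b _ => key b).trans (by convert rfl)

end EdgeExpl

end Summit.CriticalPhenomena.PercolationContinuityZ3.Theorems.Pcint

end
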